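import Summits.BirchSwinnertonDyer.BirchSwinnertonDyer.Theorems.KimAtThreeDeepLowerS24DeepTower
import Summits.BirchSwinnertonDyer.BirchSwinnertonDyer.Theorems.KimAtThreeDeepLowerS24DeepRestriction
import Summits.BirchSwinnertonDyer.BirchSwinnertonDyer.Theorems.KimAtThreeShallowEqDeepGoodCoreVertexHord
import Summits.BirchSwinnertonDyer.BirchSwinnertonDyer.Theorems.KimAtThreeShallowEqDeepGoodCoreVertexCore
import Summits.BirchSwinnertonDyer.Rank1Residual.GaloisImage.SakamotoN11InstanceWeil
import Summits.BirchSwinnertonDyer.Rank1Residual.GaloisImage.KolyvaginInjectivityAllDepthsEnd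
import Summits.BirchSwinnertonDyer.Rank1Residual.GaloisImage.CanonicalKolyvaginDatumAdmissibleDeep
import Literature.NumberTheory.GaloisCohomology.Sakamoto2024KolyvaginRankOne
import HarnessLib

/-!
# S24-DEEP (1) on the `3`-adic tower FROM THE PINNED [S24] FACT: `KS₁(E[3^k·3], 𝓕_can, 𝒫′)` free of rank
# one and evaluation bijective at the core vertices, for the DEEP class `𝒫′`, given ONE good core vertex
# — the flagged port replaced by Sakamoto 2024 Thm. 4.4 (1) AS PRINTED plus kernel theorems
# (route `KimAtThreeKolyvagin`, rung W2; cell `bsd-addord`, seat `bsd-addord-w2-c2` gen 5)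

HONEST FRAMING. ONE theorem, no definition, no named fact asserted, no `sorry`; nothing booked, no mark
moved; BSD is not proved by any of this. CONDITIONAL on the PUBLISHED, pinned Literature fact
`Sakamoto2024.kolyvaginSystems_freeRankOne_zmod_three_pow` ([S24] Thm. 4.4 (1) over `ℤ/3^m` for Sakamoto's
OWN prime set; JTNB 36 (2024), refereed) — in place of the FLAGGED PORT S24-DEEP (1)
(`GaloisImage.S24Deep.kolyvaginSystems_freeRankOne_zmod_three_pow_deep`, `S24-DEEP-PORT@3`: the same
statement for the deep SUB-class, "not a printed sentence"), which n1011's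
`kolyvaginSystems_freeRankOne_propagatedSelmerStructure_deep_of_towerSurj` consumes on every `t ≥ 1` row of
the W2 cruxes (19075 / 19076 / 19077 additive-defect stubs via PORT₂, kim3's END theorems).

THE ARGUMENT (Mazur–Rubin's remark that sub-classes `𝒫_t ⊂ 𝒫 ⊂ 𝒫_1` are harmless, Mem. AMS 799 §3.5
(H.5) / Cor. 4.5.2 (iv), made formal): let `D` be a datum on `E[3^k·3]` (`1 ≤ k ≤ k′`) over the deep class
`𝒫′ = frobeniusClassPrimes (E[3^{k′}·3]) S τ 3^{k′+1}`. (i) EXTEND `D` to a datum `D̂` on Sakamoto's pinned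
class `𝒫 ⊇ 𝒫′` of `E[3^k·3]` with the same transverse conditions and the same comparison maps on `𝒫′`
(`…S24DeepTower.exists_extension_to_frobeniusClassPrimes`); the PINNED fact under the tower (n1011's
`kolyvaginSystems_freeRankOne_propagatedSelmerStructure_of_towerSurj`) makes `KS₁(D̂)` free of rank one with
evaluation bijective at every level with `λ^* = 0`. (ii) RIGIDITY on `𝒫′` at every depth WITHOUT the port
(this seat's `…S24DeepRigidity`, from the deep Lemma 5.2 → connectedness of `𝒳⁰` on the deep class at
`m = 1` → n1011's all-depth dévissage), along the deep TOWER through `D` (`…S24DeepTower`). (iii) RESTRICTION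
`KS₁(D̂) → KS₁(D)` is then a bijection (`…S24DeepRestriction`), whence the conclusion for `D`. The one
external input is a level `n₀` of `𝒫′` that is a GOOD CORE VERTEX in the residual Kummer currency
(`H¹_{𝓚̄(n₀)^*}(ℚ, E[3]^D) = 0` — supplied on the W2 rows by kim3 / w2-c3's
`KimAtThreeShallowEqDeepGoodCoreVertex…exists_goodCoreVertex_rat_three_deep` files), read in both
currencies by w2-c3's `lambdaStar_induced_atLevel_eq_zero_rat_three_deep` (pinned clause) and
`dualSelmerGroup_propagatedOne_atLevel_eq_bot_of_kummer` (residual clause).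

* **`kolyvaginSystems_freeRankOne_propagatedSelmerStructure_deep_of_pinned`** — binders of n1011's
  `…_deep_of_towerSurj` VERBATIM with `hS24d` REPLACED by the pinned fact `hS24`, plus `1 ≤ k` and the good
  core vertex `n₀` (`hn₀`, `hbot`); SAME conclusion.

References: R. Sakamoto, JTNB **36** (2024) Thm. 4.4 (1) (p. 926), Lemma 5.2, §6 [Sakamoto2024]; B. Mazur,
K. Rubin, Mem. AMS **799** (2004) §3.5 (H.5) (p. 27), Cor. 4.5.2 (iv) (p. 48), Thm. 4.4.1, Prop. A.2
[MazurRubin2004]; K. Rubin, PCMI 18 (2011) Cor. 2.8.9 [Rubin2011].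
-/

set_option autoImplicit false
-- the Theorems namespace of a single-conjunct summit repeats the summit name by design (D-0017)
set_option linter.dupNamespace false

noncomputable section

open scoped Classical NumberField ContRepresentation
open Function Field NumberField IsDedekindDomain
open WeierstrassCurve Literature.NumberTheory.EllipticCurves Literature.NumberTheory.EllipticCurves.Rank1Residual
  Literature.NumberTheory.GaloisRepresentations
  Literature.NumberTheory.GaloisRepresentations.DiscreteGaloisModule Literature.NumberTheory.GaloisCohomology

namespace Summit.BirchSwinnertonDyer.BirchSwinnertonDyer.Theorems.KimAtThreeDeepLowerS24DeepOfPinned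

open Summit.BirchSwinnertonDyer.Rank1Residual.GaloisImage
open Summit.BirchSwinnertonDyer.BirchSwinnertonDyer.Theorems.KimAtThreeDeepLowerS24DeepTower
open Summit.BirchSwinnertonDyer.BirchSwinnertonDyer.Theorems.KimAtThreeDeepLowerS24DeepRestriction
open Summit.BirchSwinnertonDyer.BirchSwinnertonDyer.Theorems.KimAtThreeDeepLowerS24DeepRigidity
open Summit.BirchSwinnertonDyer.BirchSwinnertonDyer.Theorems.KimAtThreeShallowEqDeepGoodCoreVertex

variable (W : WeierstrassCurve ℚ) [W.IsElliptic]

/-- **S24-DEEP (1) under the `3`-adic tower from the PINNED [S24] Thm. 4.4 (1), given one good core vertex.**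
For `1 ≤ k ≤ k′`, `S ⊇ ∞ ∪ {3} ∪ {bad}`, and a Kolyvagin datum `D` of `E[3^k·3]` on the DEEP class through
`E[3^{k′}·3]` with cyclotomic transverse conditions and canonical comparison maps, and a level `n₀` of the
class whose residual KUMMER level structure has trivial dual Selmer group:
`KS₁(E[3^k·3], 𝓕_can, 𝒫′)` is free of rank one over `ℤ/3^{k+1}` and `κ ↦ κ_d` is bijective at every level
`d` with `λ^*(d) = 0` — the conclusion of n1011's `…_deep_of_towerSurj` with the port `hS24d` replaced by the
pinned fact `hS24` (PUB). [cite: Sakamoto2024, Thm. 4.4 (1) (p. 926)]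
[cite: MazurRubin2004, §3.5 (H.5) (p. 27), Cor. 4.5.2 (iv) (p. 48) and Thm. 4.4.1] [cite: Rubin2011, Cor. 2.8.9 (2) (p. 25)] -/
theorem kolyvaginSystems_freeRankOne_propagatedSelmerStructure_deep_of_pinned
    (hS24 : Sakamoto2024.kolyvaginSystems_freeRankOne_zmod_three_pow) {k k' : ℕ} (hk : 1 ≤ k)
    (hkk' : k ≤ k')
    [Finite (geomTorsion W ((3 : ℕ) : ℤ))] [Finite (geomTorsion W (((3 : ℕ) : ℤ) ^ k * ((3 : ℕ) : ℤ)))]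
    [Finite (geomTorsion W (((3 : ℕ) : ℤ) ^ k' * ((3 : ℕ) : ℤ)))]
    (htower : ∀ n : ℕ, W.HasSurjectiveModNGaloisRep (3 ^ n : ℕ))
    (τ : absoluteGaloisGroup ℚ) (hτμ : τ ∈ rootsOfUnityFixer ℚ (3 ^ (k' + 1)))
    (hτq' : Nonempty (cokerSubOne (W.torsionGaloisModule (((3 : ℕ) : ℤ) ^ k' * ((3 : ℕ) : ℤ))) τ ≃+
      ZMod (3 ^ (k' + 1))))
    (inv : LocalInvariants ℚ 3) (hperf : inv.IsPerfect) (hsum : inv.SumLocalTermEqZero)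
    (hcompl : inv.SelmerComplement)
    (hEP : ∀ v : HeightOneSpectrum (𝓞 ℚ), localEulerPoincareCharacteristic (v.adicCompletion ℚ))
    (S : Finset (Place ℚ)) (hS : ∀ w : InfinitePlace ℚ, (Sum.inl w : Place ℚ) ∈ S)
    (h3S : ∀ v : HeightOneSpectrum (𝓞 ℚ), ((3 : ℕ) : 𝓞 ℚ) ∈ v.asIdeal → (Sum.inr v : Place ℚ) ∈ S)
    (hbadS : ∀ v : HeightOneSpectrum (𝓞 ℚ), ¬ W.HasGoodReductionAt v → (Sum.inr v : Place ℚ) ∈ S)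
    (D : KolyvaginDatum (W.torsionGaloisModule (((3 : ℕ) : ℤ) ^ k * ((3 : ℕ) : ℤ))))
    (η : (q : HeightOneSpectrum (𝓞 ℚ)) → (ZMod (Ideal.absNorm q.asIdeal))ˣ)
    (hP : D.primes = frobeniusClassPrimes (W.torsionGaloisModule (((3 : ℕ) : ℤ) ^ k' * ((3 : ℕ) : ℤ)))
      {v | (Sum.inr v : Place ℚ) ∈ S} τ (3 ^ (k' + 1)))
    (hT : D.transverse = cyclotomicTransverse (W.torsionGaloisModule (((3 : ℕ) : ℤ) ^ k * ((3 : ℕ) : ℤ))))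
    (hD : D.HasCanonicalComparison (3 ^ (k + 1)) η)
    {n₀ : Finset (HeightOneSpectrum (𝓞 ℚ))} (hn₀ : D.IsLevel n₀)
    (hbot : (inv.dualSelmerStructure (W.torsionGaloisModule ((3 : ℕ) : ℤ))
      ((W.kummerSelmerStructure ((3 : ℕ) : ℤ)).transverseAt
        (cyclotomicTransverse (W.torsionGaloisModule ((3 : ℕ) : ℤ))) n₀)).selmerGroup = ⊥) :
    KolyvaginSystem.IsFreeRankOneZMod (D.kolyvaginSystems (propagatedSelmerStructure W 3 k))
        (3 ^ (k + 1)) ∧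
      ∀ (d : Finset (HeightOneSpectrum (𝓞 ℚ))) (hd : D.IsLevel d),
        LocalInvariants.lambdaStar inv ((D.atLevel (propagatedSelmerStructure W 3 k) d).induced
          (W.torsionMulBy (((3 : ℕ) : ℤ) ^ k) ((3 : ℕ) : ℤ))) 3 = 0 →
        Function.Bijective fun κ : D.kolyvaginSystems (propagatedSelmerStructure W 3 k) =>
          (⟨κ.1 d, ((KolyvaginDatum.mem_kolyvaginSystems_iff D _ κ.1).mp κ.2).mem_selmerGroup
              d hd⟩ : (D.atLevel (propagatedSelmerStructure W 3 k) d).selmerGroup) := by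
  haveI : Fact (Nat.Prime 3) := ⟨Nat.prime_three⟩
  -- `k = j + 1`
  obtain ⟨j, rfl⟩ : ∃ j, k = j + 1 := ⟨k - 1, by omega⟩
  have hjk' : j ≤ k' := (Nat.le_succ j).trans hkk'
  haveI hfinall : ∀ i : ℕ, Finite (geomTorsion W (((3 : ℕ) : ℤ) ^ i * ((3 : ℕ) : ℤ))) := fun i =>
    finite_geomTorsion_pow_mul W 3 i
  have h3 : W.HasSurjectiveModNGaloisRep ((3 : ℕ) : ℤ) := by simpa using htower 1
  have hunro : inv.UnramifiedOrthogonal :=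
    UnramifiedCup.unramifiedOrthogonal_of_isPerfect inv Nat.prime_three.isPrimePow hperf
  -- the `τ`-data at every level `≤ k′`, and on `E[3]`
  have hτ : ∀ i, i ≤ k' → Nonempty (cokerSubOne (W.torsionGaloisModule (((3 : ℕ) : ℤ) ^ i * ((3 : ℕ) : ℤ))) τ ≃+
      ZMod (3 ^ (i + 1))) := by
    intro i hi
    have hl' : ((3 : ℕ) : ℤ) ^ (k' + 1) = ((3 : ℕ) : ℤ) ^ k' * ((3 : ℕ) : ℤ) := pow_succ _ _
    have hl : ((3 : ℕ) : ℤ) ^ (i + 1) = ((3 : ℕ) : ℤ) ^ i * ((3 : ℕ) : ℤ) := pow_succ _ _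
    have h1 : Nonempty (cokerSubOne (W.torsionGaloisModule (((3 : ℕ) : ℤ) ^ (k' + 1))) τ ≃+
        ZMod (3 ^ (k' + 1))) := by
      rw [hl']; exact hτq'
    have h := nonempty_cokerSubOne_equiv_zmod_pow_of_le W Nat.prime_three (Nat.succ_le_succ hi) τ h1
    rw [hl] at h
    exact h
  have hτq₁ : Nonempty (cokerSubOne (W.torsionGaloisModule ((3 : ℕ) : ℤ)) τ ≃+ ZMod 3) := by
    have h := hτ 0 (Nat.zero_le _)
    have hl : ((3 : ℕ) : ℤ) ^ 0 * ((3 : ℕ) : ℤ) = ((3 : ℕ) : ℤ) := by rw [pow_zero, one_mul]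
    rw [hl] at h
    simpa using h
  have hτμk : τ ∈ rootsOfUnityFixer ℚ (3 ^ (j + 1 + 1)) :=
    rootsOfUnityFixer_le_of_dvd ℚ (pow_dvd_pow 3 (Nat.succ_le_succ hkk')) hτμ
  -- `η′` generating everywhere, `D` still canonical for `η′`
  obtain ⟨η', -, hη', hDη'⟩ := exists_eta_eq_on_primes_forall_zpowers_eq_top
    (W.torsionGaloisModule (((3 : ℕ) : ℤ) ^ (j + 1) * ((3 : ℕ) : ℤ))) hD
  -- (i) the extension `D̂` to the pinned class at level `k`, and the pinned fact for it under the tower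
  haveI : NeZero (3 ^ (j + 1 + 1)) := ⟨pow_ne_zero _ three_ne_zero⟩
  obtain ⟨Dh, hPh, hTh, hfsh, hDh⟩ := exists_extension_to_frobeniusClassPrimes
    (W.torsionGaloisModule (((3 : ℕ) : ℤ) ^ (j + 1) * ((3 : ℕ) : ℤ))) {v | (Sum.inr v : Place ℚ) ∈ S}
    hτμk (hτ (j + 1) hkk') D η' hη' hDη'
  have hsub : D.primes ⊆ Dh.primes := by
    rw [hP, hPh]
    exact S24Deep.frobeniusClassPrimes_torsion_pow_mul_mono W ((3 : ℕ) : ℤ) hkk' _ τ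
      (pow_dvd_pow 3 (Nat.succ_le_succ hkk'))
  have htr : D.transverse = Dh.transverse := hTh.symm
  have hThc : Dh.transverse =
      cyclotomicTransverse (W.torsionGaloisModule (((3 : ℕ) : ℤ) ^ (j + 1) * ((3 : ℕ) : ℤ))) :=
    hTh.trans hT
  let T : Finset (HeightOneSpectrum (𝓞 ℚ)) := S.preimage Sum.inr Sum.inr_injective.injOn
  have h3T : ∀ v : HeightOneSpectrum (𝓞 ℚ), ((3 : ℕ) : 𝓞 ℚ) ∈ v.asIdeal → v ∈ T :=
    fun v hv => Finset.mem_preimage.mpr (h3S v hv)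
  have hbadT : ∀ v : HeightOneSpectrum (𝓞 ℚ), ¬ W.HasGoodReductionAt v → v ∈ T :=
    fun v hv => Finset.mem_preimage.mpr (hbadS v hv)
  have hpin := kolyvaginSystems_freeRankOne_propagatedSelmerStructure_of_towerSurj W hS24 (j + 1) htower τ
    hτμk (hτ (j + 1) hkk') inv hperf hsum hunro hcompl S hS
    (fun v hv => not_mem_and_isUnramifiedAt_of_not_mem W 3 (j + 1) S h3S hbadS hv)
    (propagatedSelmerStructure_isUnramifiedOutside W 3 (j + 1) S hS h3S hbadS) (fun v _ => hEP v)
    (hasCoreRank_one_propagatedSelmerStructureOne_of_isPerfect_of_localEuler W inv hperf hsum hcompl hEP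
      T h3T hbadT)
    Dh η' hPh hThc hDh
  -- (ii) the deep tower through `D`, the `E[3]`-datum on the deep class, and rigidity at `n₀`
  obtain ⟨Dt, hDtk, hDt⟩ := exists_deepTower_torsion_pow_mul W hkk' {v | (Sum.inr v : Place ℚ) ∈ S}
    hτμ hτ D η' hη' hP hT hDη'
  obtain ⟨D₁, hP₁, hT₁, hD₁⟩ := exists_deepDatum_torsion_three W k' {v | (Sum.inr v : Place ℚ) ∈ S}
    hτμ hτq₁ η' hη'
  have hn₀' : D₁.IsLevel n₀ := fun q hq => by
    rw [hP₁]
    exact hP ▸ hn₀ hq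
  have hbot₁ : (inv.dualSelmerStructure (W.torsionGaloisModule ((3 : ℕ) : ℤ))
      (D₁.atLevel (W.kummerSelmerStructure ((3 : ℕ) : ℤ)) n₀)).selmerGroup = ⊥ := by
    change (inv.dualSelmerStructure _ ((W.kummerSelmerStructure ((3 : ℕ) : ℤ)).transverseAt
      D₁.transverse n₀)).selmerGroup = ⊥
    rw [hT₁]
    exact hbot
  have hcore₁ : LocalInvariants.lambdaStar inv (D₁.atLevel (propagatedSelmerStructureOne W 3) n₀) 3 = 0 := by
    have h0 := dualSelmerGroup_propagatedOne_atLevel_eq_bot_of_kummer W 3 inv D₁ n₀ hbot₁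
    unfold LocalInvariants.lambdaStar
    rw [h0, AddSubgroup.card_bot, Nat.log_one_right]
  have hadm : ∀ i, i ≤ j + 1 → (Dt i).IsAdmissible := fun i hi =>
    isAdmissible_of_hasCanonicalComparison_torsion_deep W i k' (hi.trans hkk') {v | (Sum.inr v : Place ℚ) ∈ S}
      hτμ (hτ i (hi.trans hkk')) (hDt i (hi.trans hkk')).1 (hDt i (hi.trans hkk')).2.2
  have hrig : ∀ κ : Finset (HeightOneSpectrum (𝓞 ℚ)) →
        galoisCohomology (W.torsionGaloisModule (((3 : ℕ) : ℤ) ^ (j + 1) * ((3 : ℕ) : ℤ))) 1,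
      D.IsKolyvaginSystem (propagatedSelmerStructure W 3 (j + 1)) κ → κ n₀ = 0 → ∀ n, κ n = 0 := by
    intro κ hκ hκ₀ n
    have hκ' : (Dt (j + 1)).IsKolyvaginSystem (propagatedSelmerStructure W 3 (j + 1)) κ := by
      rw [hDtk]; exact hκ
    exact apply_eq_zero_of_apply_eq_zero_allDepths_le_deep W h3 hk hkk' τ hτμ hτq₁
      (fun i hi => hτ i (hi.trans hkk')) inv hperf hsum hunro hcompl hEP S hS h3S hbadS
      (fun i _ P hP' => Transport.geomTorsion_eq_zero_of_fixed_of_surj W h3 i P fun σ => by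
        have h := hP' σ
        rwa [torsionGaloisModule_apply_apply] at h)
      (TorsionLevel.geomTorsion_three_eq_zero_of_fixed_of_surj W h3) η' Dt D₁ hP₁ hT₁ hD₁
      (fun i hi => (hDt i (hi.trans hkk')).1) (fun i hi => (hDt i (hi.trans hkk')).2.1)
      (fun i hi => (hDt i (hi.trans hkk')).2.2) hadm hn₀' hcore₁ hκ' hκ₀ n
  -- the pinned bijectivity at `n₀` (a level of `D̂`; `λ^* = 0` there from the Kummer currency)
  have hn₀h : Dh.IsLevel n₀ := isLevel_of_isLevel_of_subset hsub hn₀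
  have hcorek : LocalInvariants.lambdaStar inv ((Dh.atLevel (propagatedSelmerStructure W 3 (j + 1)) n₀).induced
      (W.torsionMulBy (((3 : ℕ) : ℤ) ^ (j + 1)) ((3 : ℕ) : ℤ))) 3 = 0 :=
    lambdaStar_induced_atLevel_eq_zero_rat_three_deep W j hτμk (hτ (j + 1) hkk') (hτ j hjk') hτq₁ inv D₁
      Dh hPh.le hT₁ hThc hn₀h hbot₁
  have hbij₀ := hpin.2 n₀ hn₀h hcorek
  -- (iii) restriction `KS₁(D̂) → KS₁(D)` is a bijection: descend both clauses
  refine ⟨isFreeRankOneZMod_of_restrict hsub htr hfsh hn₀ hbij₀ hrig hpin.1, fun d hd hlam => ?_⟩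
  have hlam' : LocalInvariants.lambdaStar inv ((Dh.atLevel (propagatedSelmerStructure W 3 (j + 1)) d).induced
      (W.torsionMulBy (((3 : ℕ) : ℤ) ^ (j + 1)) ((3 : ℕ) : ℤ))) 3 = 0 := by
    rw [← atLevel_eq_of_transverse_eq htr d]
    exact hlam
  exact bijective_eval_of_restrict hsub htr hfsh hn₀ hbij₀ hrig hd
    (hpin.2 d (isLevel_of_isLevel_of_subset hsub hd) hlam')

end Summit.BirchSwinnertonDyer.BirchSwinnertonDyer.Theorems.KimAtThreeDeepLowerS24DeepOfPinned

end
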